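import Literature.IUT.HodgeTheaters.FPrimeStripsRealifiedSlot
import Literature.IUT.HodgeTheaters.HodgeTheaterModelFKit
import Literature.IUT.HodgeTheaters.GlobalRealifiedFrobenioidsRigidity
import HarnessLib

/-!
# [IUTchI] Rmk 5.2.1 (ii) / Ex 3.5 (i)(ii) at the GENUINE index set and scalars: the supplied `ℱ^⊩` slot over a place kit
# `𝕍 = V̲` of REAL initial Θ-data with `c_v := 1/[K_v̲:(F_mod)_v]`, and over the §3 ↔ §5 dictionary kit `FKitLink.toFKit` (PROOF-ONLY)

S. Mochizuki, *Inter-universal Teichmüller theory I*, kurims manuscript (May 2020) [paper:url-690e7b3c6199]: Ex 3.5 (i) p. 84 (own render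
p0084.txt l.50–61) «the isomorphism of topological monoids [which are isomorphic to `ℝ_{≥0}`] `ρ_v : Φ_{𝒞^⊩_mod,v} ⥲ Φ^rlf_{𝒞^⊢_v}` induced by
`𝒞_{ρ_v}` — which … is easily computed to be given by the assignment `log^⊢_mod(p_v) ↦ (1/[K_v:(F_mod)_v]) log_Φ(p_v)`»; Ex 3.5 (ii) p. 85
(l.68–73) «`𝔉^⊩_mod := (𝒞^⊩_mod, Prime(𝒞^⊩_mod) ⥲ 𝕍, {ℱ^⊢_v}_{v∈𝕍}, {ρ_v}_{v∈𝕍})`»; Rmk 5.2.1 (ii) p. 143 (l.21–30) «it follows immediately [cf.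
Definition 5.2, (i)] from the rigidity of the divisor monoids associated to the Frobenioids that appear at each of the components at
`v ∈ 𝕍` of an `ℱ`-prime-strip … that one may also construct from the `ℱ`-prime-strip `‡𝔉`, via a functorial algorithm [cf. the
constructions of Example 3.5, (i), (ii)], a collection of data `‡𝔉 ↦ ‡𝔉^⊩` … which is isomorphic to the collection of data `𝔉^⊩_mod` of
Example 3.5, (ii), i.e., which forms an `ℱ^⊩`-prime-strip».  Claim key `Mochizuki2012` DISPUTED (D-0012); nothing of the series is
asserted; no side is taken on [IUTchIII] Cor. 3.12.  abc-iut cell, seat abc-iut-w4-d009 (gen 9), row «K4-RECLOSE-L6 F-1998 SITES»; sequel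
to `FPrimeStripsRealifiedSlot.lean` (the transformer `FK.withRlfSlot c hc` and `rlfOfIsStrip_withRlfSlot`).

PROOF-ONLY (0 definitions).  The transformer takes the positive scalars `c` of the `ρ_v` as INPUT; here they are instantiated AT THE
DATA OF RECORD: over abc-iut-L5-t4's place kit `T : D.PlaceKit` of REAL initial Θ-data `D` (index set `T.kit.V ≃ V̲`, `PlaceKitBridge.lean`)
the scalar at the index `x` is abc-iut-L5-t2's printed `InitialThetaData.rhoScalar D (T.val x) = [K_v̲:(F_mod)_v]⁻¹` (`GlobalRealifiedFrobenioids.lean`;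
positive by this seat's gen-0 `rhoScalar_pos`).  Results: `RlfOfIsStrip` for EVERY kit over such a place kit with these scalars
(`rlfOfIsStrip_withRlfSlot_placeKit`); in particular for the §3 ↔ §5 DICTIONARY kit `Lk.toFKit` of abc-iut-L5's `HodgeTheaterModel.FKitLink`
(`HodgeTheaterModelFKit.lean`) with its hypothesis slot C2 (`rlfOf/rlfOfMap/rlfFm_rlfOf`) OVERRIDDEN by the algorithm
(`rlfOfIsStrip_toFKit_withRlfSlot`), whose model `𝔉^⊩_mod` then READS `({dashOf_v(ℱ̲_v)}_v, {[K_v̲:(F_mod)_v]⁻¹}_v)` — abc-iut-L5-t2's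
reference `ℱ^⊢`-data and printed scalars (`toFKit_withRlfSlot_rlfModel_fm`, `…_rhoCoeff`).  HONEST SCOPE: the `ℱ`/`ℱ^⊢`/`ℱ̲` kinds of the
dictionary kit remain abc-iut-L5-t2's INTERFACE `HodgeTheaterModel D` read through the link (hub H2's genuine instances pending);
re-closed-at-a-carrier ≠ proved-in-print; typed ≠ endorsed.
-/

noncomputable section

namespace Literature.IUT.HodgeTheaters

open CategoryTheory PMBaseKit

universe uK u v w

variable {F : Type u} {K : Type v} {Fbar : Type w} [Field F] [NumberField F] [Field K] [NumberField K] [Algebra F K]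
  [Field Fbar] [Algebra F Fbar] [Algebra K Fbar] {E : WeierstrassCurve F} [E.IsElliptic] {l : ℕ} {P : BadPlacePredicates K}
  {D : InitialThetaData F K Fbar E l P}

namespace InitialThetaData.PlaceKit

/-- **IUTchI:Ex3.5(i)** (kurims p.84) the printed scalars `[K_v̲:(F_mod)_v]⁻¹` of the `ρ_v`, read at the indices of a place kit, are
positive. [cite: Mochizuki2012, Ex 3.5 (i) p.84] -/
theorem rhoScalar_val_pos (T : D.PlaceKit.{uK}) (x : T.kit.V) : 0 < (D.rhoScalar (T.val x) : ℝ) :=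
  NNReal.coe_pos.mpr (D.rhoScalar_pos (T.val x))

/-- **IUTchI:Rmk5.2.1(ii)** (kurims p.143) / **IUTchI:Ex3.5(i)** (p.84) — `RlfOfIsStrip` (FACT-LIST F-1998's shape) for EVERY `ℱ`-prime-strip kit
over a place kit `𝕍 = V̲` of REAL initial Θ-data, with the `ℱ^⊩` slot supplied by the algorithm at THE PRINTED SCALARS
`c_v̲ := [K_v̲:(F_mod)_v]⁻¹` (abc-iut-L5-t2's `rhoScalar`): NO hypothesis. [cite: Mochizuki2012, Rmk 5.2.1 (ii) p.143] -/
theorem rlfOfIsStrip_withRlfSlot_placeKit (T : D.PlaceKit.{uK}) {M : T.kit.MultKit} (FK : T.kit.FKit M) :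
    (FK.withRlfSlot (fun x => (D.rhoScalar (T.val x) : ℝ)) (rhoScalar_val_pos T)).RlfOfIsStrip :=
  FK.rlfOfIsStrip_withRlfSlot _ _

end InitialThetaData.PlaceKit

namespace HodgeTheaterModel.FKitLink

variable {Mo : HodgeTheaterModel.{u, v, w, uK} D} {T : InitialThetaData.PlaceKit.{uK} D} {M : T.kit.MultKit}
  (Lk : Mo.FKitLink T M)

/-- **IUTchI:Rmk5.2.1(ii)** (kurims p.143) — `RlfOfIsStrip` for the §3 ↔ §5 DICTIONARY kit `Lk.toFKit` (abc-iut-L5's `HodgeTheaterModelFKit.lean`)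
with its hypothesis slot C2 (`rlfOf/rlfOfMap/rlfFm_rlfOf`) OVERRIDDEN by the printed algorithm at the printed scalars: NO hypothesis.
[cite: Mochizuki2012, Rmk 5.2.1 (ii) p.143] -/
theorem rlfOfIsStrip_toFKit_withRlfSlot :
    (Lk.toFKit.withRlfSlot (fun x => (D.rhoScalar (T.val x) : ℝ))
      (InitialThetaData.PlaceKit.rhoScalar_val_pos T)).RlfOfIsStrip :=
  InitialThetaData.PlaceKit.rlfOfIsStrip_withRlfSlot_placeKit T Lk.toFKit

/-- **IUTchI:Ex3.5(ii)** (kurims p.85 «`𝔉^⊩_mod := (𝒞^⊩_mod, Prime(𝒞^⊩_mod) ⥲ 𝕍, {ℱ^⊢_v}_{v∈𝕍}, {ρ_v}_{v∈𝕍})`») the model `𝔉^⊩_mod` of the dictionary kit with the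
supplied slot has `ℱ^⊢`-data abc-iut-L5-t2's REFERENCE data `ℱ^⊢_v = dashOf_v(ℱ̲_v)` of Examples 3.2 (v), 3.3 (i), 3.4 (ii) …
[cite: Mochizuki2012, Ex 3.5 (ii) p.85] -/
theorem toFKit_withRlfSlot_rlfModel_fm (x : T.kit.V) :
    (Lk.toFKit.withRlfSlot (fun x => (D.rhoScalar (T.val x) : ℝ))
      (InitialThetaData.PlaceKit.rhoScalar_val_pos T)).rlfModel.fm x = (Mo.dashOf (T.e x)).obj (Mo.Fref (T.e x)) := rfl

/-- **IUTchI:Ex3.5(i)** (kurims p.84 «`log^⊢_mod(p_v) ↦ (1/[K_v:(F_mod)_v]) log_Φ(p_v)`») … and scalars the printed `[K_v̲:(F_mod)_v]⁻¹`.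
[cite: Mochizuki2012, Ex 3.5 (i) p.84] -/
theorem toFKit_withRlfSlot_rlfModel_rhoCoeff (x : T.kit.V) :
    (Lk.toFKit.withRlfSlot (fun x => (D.rhoScalar (T.val x) : ℝ))
      (InitialThetaData.PlaceKit.rhoScalar_val_pos T)).rlfModel.rhoCoeff x = (D.rhoScalar (T.val x) : ℝ) := rfl

/-- **IUTchI:Rmk5.2.1(ii)** (kurims p.143) … and the algorithm sends an `ℱ`-datum family `{‡𝒞_v}` of the dictionary kit to
`({cDash_v(‡𝒞_v)}, {[K_v̲:(F_mod)_v]⁻¹})` — the link's mono-analyticisation `cDash` (Rmk 5.2.1 (ii) «`‡𝔉 ↦ ‡𝔉^⊢`») and the printed scalars.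
[cite: Mochizuki2012, Rmk 5.2.1 (ii) p.143] -/
theorem toFKit_withRlfSlot_rlfOf_fm (G : ∀ x, Lk.LocC x) (x : T.kit.V) :
    ((Lk.toFKit.withRlfSlot (fun x => (D.rhoScalar (T.val x) : ℝ))
      (InitialThetaData.PlaceKit.rhoScalar_val_pos T)).rlfOf G).fm x = (Lk.cDash x).obj (G x) := rfl

end HodgeTheaterModel.FKitLink

end Literature.IUT.HodgeTheaters
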